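import Literature.InformationTheory.QuantumCodes.CSSEquivalenceNoise
import Literature.InformationTheory.QuantumCodes.SyndromeDecodingCSS
import HarnessLib

/-!
# Re-indexed CSS codes: PULLED-BACK decoders (every decoder of the re-indexed code is the transport of one of the
# original code), minimum weight is preserved, and the code-capacity failure sums agree — both sectors

Topic `Literature/InformationTheory/QuantumCodes` (venture QEC, LADDER-QEC rung Q5; qec-type-09 gen 5). `CSSEquivalenceNoise.lean`
(qec-lit-2) proves `CSSCode.zFailure_reindex`: the TRANSPORTED decoder `s' ↦ D(s' ∘ eX) ∘ eQ⁻¹` of `C.reindex eX eZ eQ` fails with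
the same probability as `D` on `C`. Threshold theorems quantify over ALL (minimum-weight) decoders of a code, so to move a
theorem from `C` to `C.reindex eX eZ eQ` one needs the converse bookkeeping, PROVED here (elementary, no named fact):

* `CSSCode.zTransport_zPullback` — every decoder `D'` of the re-indexed `Z` sector is the transport of its PULL-BACK
  `s ↦ D'(s ∘ eX⁻¹) ∘ eQ`;
* `CSSCode.isMinWeight_zPullback` — if `D'` is minimum-weight for `(C.reindex …).zSyndrome` w.r.t. `ker H'^X` and the Hamming
  weight, its pull-back is minimum-weight for `C.zSyndrome` w.r.t. `ker H^X`;
* `CSSCode.zFailure_pullback` — the `Z`-sector code-capacity failure sum of `D'` on the re-indexed code equals that of its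
  pull-back on `C`, at every flip rate `p`;
* the `X`-sector twins `CSSCode.swap_reindex`, `isMinWeight_xPullback`, `xFailure_pullback` (via the `X ↔ Z` exchange:
  `(C.reindex eX eZ eQ).swap = C.swap.reindex eZ eX eQ`, definitional).

(The space-time analogues are `CSSPhenom.isMinWeight_pullback` / `CSSPhenom.phenomFailureProb_pullback` of
`CSSPhenomenologicalReindex.lean`.) Used by `Summits/Ventures/QEC/Thresholds/ToricCodeHGPThresholdsTransport.lean`.

## References

* [LinPryadko2024] H.-K. Lin, L. P. Pryadko, Phys. Rev. A 109 (2024) 022407, arXiv:2306.16400, §4.2 Thm 6 (permutation-equivalent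
  CSS codes have identical parameters).
* [DennisEtAl2002] E. Dennis, A. Kitaev, A. Landahl, J. Preskill, J. Math. Phys. 43 (2002) 4452, §4.4 eq. (prob_E).
-/

namespace Literature.InformationTheory.QuantumCodes

open Finset Matrix

namespace CSSCode

variable {RX RZ Q RX' RZ' Q' : Type*}

/-- The `X ↔ Z` exchange commutes with re-indexing: `(C.reindex eX eZ eQ).swap = C.swap.reindex eZ eX eQ` (definitional).
[cite: LinPryadko2024, §4.2 Thm 6] -/
theorem swap_reindex [Fintype Q] [Fintype Q'] (C : CSSCode RX RZ Q) (eX : RX ≃ RX') (eZ : RZ ≃ RZ') (eQ : Q ≃ Q') :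
    (C.reindex eX eZ eQ).swap = C.swap.reindex eZ eX eQ := rfl

/-- **Every decoder of the re-indexed code is a transport**: `D' = s' ↦ (pullback D')(s' ∘ eX) ∘ eQ⁻¹` with
`pullback D' = s ↦ D'(s ∘ eX⁻¹) ∘ eQ`. [cite: LinPryadko2024, §4.2 Thm 6 (permutation equivalence is invertible)] -/
theorem zTransport_zPullback (eX : RX ≃ RX') (eQ : Q ≃ Q') (D' : Decoder (RX' → ZMod 2) (Q' → ZMod 2)) :
    (fun s' : RX' → ZMod 2 => (fun s : RX → ZMod 2 => D' (s ∘ ⇑eX.symm) ∘ ⇑eQ) (s' ∘ ⇑eX) ∘ ⇑eQ.symm) = D' := by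
  funext s' q'
  have hs : (s' ∘ ⇑eX) ∘ ⇑eX.symm = s' := by
    funext r; simp only [Function.comp_apply, Equiv.apply_symm_apply]
  simp only [Function.comp_apply, hs, Equiv.apply_symm_apply]

/-- The `Z`-syndrome of the re-indexed code on `e ∘ eQ⁻¹`, read back along `eX⁻¹`, is the `Z`-syndrome of `e`:
`(H'^X (e ∘ eQ⁻¹)) ∘ eX... ` in the form `C'.zSyndrome (e ∘ eQ⁻¹) ∘ ... = ` used below. [cite: LinPryadko2024, App. proof of Thm 6(i)] -/
theorem reindex_zSyndrome_comp_symm [Fintype Q] [Fintype Q'] (C : CSSCode RX RZ Q) (eX : RX ≃ RX') (eZ : RZ ≃ RZ')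
    (eQ : Q ≃ Q') (e : Q → ZMod 2) :
    (C.reindex eX eZ eQ).zSyndrome (e ∘ ⇑eQ.symm) ∘ ⇑eX = C.zSyndrome e := by
  have h := C.reindex_zSyndrome_comp eX eZ eQ (e ∘ ⇑eQ.symm)
  have he : (e ∘ ⇑eQ.symm) ∘ ⇑eQ = e := by
    funext q; simp only [Function.comp_apply, Equiv.symm_apply_apply]
  rwa [he] at h

/-- **Minimum weight is preserved by pull-back (`Z` sector)**: if `D'` is a minimum-weight decoder of the re-indexed code
(syndrome `H'^X`, undetectable set `ker H'^X`, Hamming weight), then `s ↦ D'(s ∘ eX⁻¹) ∘ eQ` is one of `C`.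
[cite: LinPryadko2024, §4.2 Thm 6 (weights are permutation invariant)] -/
theorem isMinWeight_zPullback [Fintype Q] [Fintype Q'] [DecidableEq Q] [DecidableEq Q'] (C : CSSCode RX RZ Q)
    (eX : RX ≃ RX') (eZ : RZ ≃ RZ') (eQ : Q ≃ Q') {D' : Decoder (RX' → ZMod 2) (Q' → ZMod 2)}
    (hD' : D'.IsMinWeight (C.reindex eX eZ eQ).zSyndrome ((C.reindex eX eZ eQ).kerX : Set (Q' → ZMod 2)) hammingNorm) :
    Decoder.IsMinWeight (fun s : RX → ZMod 2 => D' (s ∘ ⇑eX.symm) ∘ ⇑eQ) C.zSyndrome (C.kerX : Set (Q → ZMod 2))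
      hammingNorm := by
  refine ⟨fun e => ?_, fun e => ?_⟩
  · -- undetectability of the net error transports along `eQ`
    have hadd := hD'.add_mem (e ∘ ⇑eQ.symm)
    rw [SetLike.mem_coe, mem_kerX_iff, reindex_HX_mulVec_eq_zero_iff] at hadd
    rw [SetLike.mem_coe, mem_kerX_iff]
    have hsyn : C.zSyndrome e ∘ ⇑eX.symm = (C.reindex eX eZ eQ).zSyndrome (e ∘ ⇑eQ.symm) := by
      rw [← C.reindex_zSyndrome_comp_symm eX eZ eQ e]
      funext r; simp only [Function.comp_apply, Equiv.apply_symm_apply]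
    have hrw : (D' ((C.reindex eX eZ eQ).zSyndrome (e ∘ ⇑eQ.symm)) + e ∘ ⇑eQ.symm) ∘ ⇑eQ =
        D' (C.zSyndrome e ∘ ⇑eX.symm) ∘ ⇑eQ + e := by
      rw [hsyn]; funext q; simp only [Function.comp_apply, Pi.add_apply, Equiv.symm_apply_apply]
    rw [← hrw]
    exact hadd
  · have hle := hD'.weight_le (e ∘ ⇑eQ.symm)
    have hsyn : C.zSyndrome e ∘ ⇑eX.symm = (C.reindex eX eZ eQ).zSyndrome (e ∘ ⇑eQ.symm) := by
      rw [← C.reindex_zSyndrome_comp_symm eX eZ eQ e]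
      funext r; simp only [Function.comp_apply, Equiv.apply_symm_apply]
    rw [hammingNorm_comp_equiv e eQ] at hle
    rw [hsyn]
    have hw : hammingNorm (D' ((C.reindex eX eZ eQ).zSyndrome (e ∘ ⇑eQ.symm)) ∘ ⇑eQ) =
        hammingNorm (D' ((C.reindex eX eZ eQ).zSyndrome (e ∘ ⇑eQ.symm))) := by
      have := hammingNorm_comp_equiv (D' ((C.reindex eX eZ eQ).zSyndrome (e ∘ ⇑eQ.symm))) eQ.symm
      rwa [Equiv.symm_symm] at this
    rw [hw]
    exact hle

open Classical in
/-- **The `Z`-sector code-capacity failure sum is preserved by pull-back**: for every decoder `D'` of `C.reindex eX eZ eQ` and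
every `p`, `Σ_{e' : D' fails} w_p(e') = Σ_{e : pullback D' fails} w_p(e)`. [cite: LinPryadko2024, §4.2 Thm 6] [cite: DennisEtAl2002, §4.4 eq. (prob_E)] -/
theorem zFailure_pullback [Fintype RZ] [Fintype RZ'] [Fintype Q] [Fintype Q'] [DecidableEq Q] [DecidableEq Q']
    (C : CSSCode RX RZ Q) (eX : RX ≃ RX') (eZ : RZ ≃ RZ') (eQ : Q ≃ Q') (D' : Decoder (RX' → ZMod 2) (Q' → ZMod 2))
    (p : ℝ) :
    (∑ e ∈ univ.filter (fun e : Q' → ZMod 2 =>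
        ¬ D'.Corrects (C.reindex eX eZ eQ).zSyndrome ((C.reindex eX eZ eQ).rowSpZ : Set (Q' → ZMod 2)) e),
        bernoulliWeight p (supp e)) =
      ∑ e ∈ univ.filter (fun e : Q → ZMod 2 =>
        ¬ Decoder.Corrects (fun s : RX → ZMod 2 => D' (s ∘ ⇑eX.symm) ∘ ⇑eQ) C.zSyndrome (C.rowSpZ : Set (Q → ZMod 2)) e),
        bernoulliWeight p (supp e) := by
  have h := C.zFailure_reindex eX eZ eQ (fun s : RX → ZMod 2 => D' (s ∘ ⇑eX.symm) ∘ ⇑eQ) p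
  rw [zTransport_zPullback eX eQ D'] at h
  exact h

/-! ### The `X` sector (via the exchange) -/

/-- **Minimum weight is preserved by pull-back (`X` sector)**: syndrome `H'^Z`, undetectable set `ker H'^Z`.
[cite: LinPryadko2024, §4.2 Thm 6] -/
theorem isMinWeight_xPullback [Fintype Q] [Fintype Q'] [DecidableEq Q] [DecidableEq Q'] (C : CSSCode RX RZ Q)
    (eX : RX ≃ RX') (eZ : RZ ≃ RZ') (eQ : Q ≃ Q') {D' : Decoder (RZ' → ZMod 2) (Q' → ZMod 2)}
    (hD' : D'.IsMinWeight (C.reindex eX eZ eQ).xSyndrome ((C.reindex eX eZ eQ).kerZ : Set (Q' → ZMod 2)) hammingNorm) :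
    Decoder.IsMinWeight (fun s : RZ → ZMod 2 => D' (s ∘ ⇑eZ.symm) ∘ ⇑eQ) C.xSyndrome (C.kerZ : Set (Q → ZMod 2))
      hammingNorm :=
  C.swap.isMinWeight_zPullback eZ eX eQ (D' := D') hD'

open Classical in
/-- **The `X`-sector code-capacity failure sum is preserved by pull-back.** [cite: LinPryadko2024, §4.2 Thm 6] [cite: DennisEtAl2002, §4.4 eq. (prob_E)] -/
theorem xFailure_pullback [Fintype RX] [Fintype RX'] [Fintype Q] [Fintype Q'] [DecidableEq Q] [DecidableEq Q']
    (C : CSSCode RX RZ Q) (eX : RX ≃ RX') (eZ : RZ ≃ RZ') (eQ : Q ≃ Q') (D' : Decoder (RZ' → ZMod 2) (Q' → ZMod 2))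
    (p : ℝ) :
    (∑ e ∈ univ.filter (fun e : Q' → ZMod 2 =>
        ¬ D'.Corrects (C.reindex eX eZ eQ).xSyndrome ((C.reindex eX eZ eQ).rowSpX : Set (Q' → ZMod 2)) e),
        bernoulliWeight p (supp e)) =
      ∑ e ∈ univ.filter (fun e : Q → ZMod 2 =>
        ¬ Decoder.Corrects (fun s : RZ → ZMod 2 => D' (s ∘ ⇑eZ.symm) ∘ ⇑eQ) C.xSyndrome (C.rowSpX : Set (Q → ZMod 2)) e),
        bernoulliWeight p (supp e) :=
  C.swap.zFailure_pullback eZ eX eQ D' p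

end CSSCode

end Literature.InformationTheory.QuantumCodes
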